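import Literature.Probability.Percolation.KozmaNitzanSeparatingTriple
import HarnessLib

/-!
# The separator class, part 1: STRUCTURE of the connection events on the two sides of `{x, a}` (PROOFS §P54 (a), step (1))

Support file (`--supports stmt-CriticalPhenomena-4575`), prover seat `prim-rate-mine-2` (lane prim-rate, constants-miner (c);
`run/shared/lean/prim/prim-rate/prim-rate-mine-2/PROOFS.md` §P54 (a) «STRUCTURE LEMMA»; BENCH row l.192 M2-R54, signed mine-ref-g54).
No definitions, no named facts, no sorries; standard axioms.  Part 2 (the moments and the SEPARATOR IDENTITIES (I1)–(I2)) is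
`PercNearOneGluingNoHeavyLowerTailQuantitativeSeparatorIdentities.lean`.

SETTING.  A finite vertex type, vertices `x ≠ a`, a set `L ∌ x, a` (the `L`-side interior); the `L`-SIDE pairs are the pairs
inside `L ∪ {x,a}` (`KNSep.sideB L {x,a}`, containing `{x,a}` itself) and the `R`-SIDE pairs are those avoiding `L` and not inside
`{x,a}` (`KNSep.sideT L {x,a}`); a configuration has NO CROSS PAIR (`KNSep.noCross`) when every open pair is on one side — which
holds almost surely when every other pair has weight `0` (`CSH.sep_noCross_of_mem_sureSet`).  Write `p ↔_L q` for «joined by open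
`L`-side pairs» (`KNSep.rB`) and `p ↔_R q` for «joined by open `R`-side pairs».  Using the tree's amalgamation along a separating set
(`KNSep.amalgam`, `KNSep.reachable_iff_rT`, `KNSep.reachable_iff_exists_rB_rT`) with the two-point separator `{x,a}` (whose glue set
is `{s(x,a)}` or `∅`, `CSH.sep_mem_glueSet_iff`, `CSH.sep_rT_glue_iff`):
* `CSH.sep_conn_xa_iff` — `x ↔ a` iff `x ↔_L a` or `x ↔_R a` (`T = A_L ∪ A_R`);
* `CSH.sep_conn_xb_iff` (`b ∈ L`) — `x ↔ b` iff `x ↔_L b`, or `a ↔_L b ∧ x ↮_L b ∧ x ↔_R a` (the paper's `F = F₁ + [ab]·T_R`);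
* `CSH.sep_conn_xu_iff` (`u ∉ L`) — `x ↔ u` iff `x ↔_R u`, or `a ↔_R u ∧ x ↮_R u ∧ x ↔_L a`.
[cite: KozmaNitzan2024, proof of Thm. 3 (pp. 10–11)] [cite: VandenbergHaggstromKahn2005, Thm. 1.3 (p. 6)]
-/

noncomputable section

namespace Summit.CriticalPhenomena.PercolationContinuityZ3.Theorems.CSH

open MeasureTheory Set unitInterval
open Literature.Probability.LatticeModels (prodBernoulli)
open Literature.Probability.Percolation
open Literature.Probability.Percolation.KNSep
open scoped Classical

variable {V : Type*}

/-! ### Combinatorics of the two sides of the separator `{x, a}` -/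

section Structure

variable {L : Set V} {x a : V}

/-- On the sure set of `w` (weight-`0` pairs closed) a separator-class configuration has no cross pair. [folklore] -/
theorem sep_noCross_of_mem_sureSet [Fintype V] {w : Sym2 V → unitInterval}
    (hcut : ∀ e, e ∉ sideB L {x, a} → e ∉ sideT L {x, a} → w e = 0)
    {ω : BondConfig V} (hω : ω ∈ sureSet w) : noCross L {x, a} ω := by
  intro e he
  by_contra h
  rw [not_or] at h
  exact (hω e).1 (hcut e h.1 h.2) he

/-- The glue set of the two-point separator `{x,a}` is contained in `{s(x,a)}`, and contains it iff `x ↔_L a`. [folklore] -/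
theorem sep_mem_glueSet_iff (ω : BondConfig V) (hxa : x ≠ a) (e : Sym2 V) :
    e ∈ glueSet L {x, a} ω ↔ e = s(x, a) ∧ rB L {x, a} ω x a := by
  induction e using Sym2.ind with
  | h p q =>
    rw [mk_mem_glueSet_iff]
    constructor
    · rintro ⟨hp, hq, hpq, hr⟩
      rcases hp with rfl | rfl <;> rcases hq with rfl | rfl
      · exact absurd rfl hpq
      · exact ⟨rfl, hr⟩
      · exact ⟨Sym2.eq_swap, hr.symm⟩
      · exact absurd rfl hpq
    · rintro ⟨he, hr⟩
      rcases Sym2.eq_iff.1 he with ⟨rfl, rfl⟩ | ⟨rfl, rfl⟩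
      · exact ⟨Or.inl rfl, Or.inr rfl, hxa, hr⟩
      · exact ⟨Or.inr rfl, Or.inl rfl, Ne.symm hxa, hr.symm⟩

/-- Glued `T`-connectivity for the separator `{x,a}`: `p ↔ q` in the `R`-side plus the virtual pair `{x,a}` (present iff
`x ↔_L a`) iff `p ↔_R q`, or the virtual pair is present and is used once. [folklore] -/
theorem sep_rT_glue_iff (ω : BondConfig V) (hxa : x ≠ a) (p q : V) :
    rT L {x, a} (glueSet L {x, a} ω) ω p q ↔
      (openGraph (ω ∩ sideT L {x, a})).Reachable p q ∨
        (rB L {x, a} ω x a ∧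
          (((openGraph (ω ∩ sideT L {x, a})).Reachable p x ∧ (openGraph (ω ∩ sideT L {x, a})).Reachable a q) ∨
            ((openGraph (ω ∩ sideT L {x, a})).Reachable p a ∧ (openGraph (ω ∩ sideT L {x, a})).Reachable x q))) := by
  unfold rT
  by_cases hr : rB L {x, a} ω x a
  · have hF : ω ∩ sideT L {x, a} ∪ glueSet L {x, a} ω = insert s(x, a) (ω ∩ sideT L {x, a}) := by
      ext e
      simp only [Set.mem_union, Set.mem_insert_iff, sep_mem_glueSet_iff ω hxa]
      tauto
    rw [hF, reachable_insert_iff]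
    constructor
    · rintro (h | h | h)
      · exact Or.inl h
      · exact Or.inr ⟨hr, Or.inl h⟩
      · exact Or.inr ⟨hr, Or.inr h⟩
    · rintro (h | ⟨-, h | h⟩)
      · exact Or.inl h
      · exact Or.inr (Or.inl h)
      · exact Or.inr (Or.inr h)
  · have hF : ω ∩ sideT L {x, a} ∪ glueSet L {x, a} ω = ω ∩ sideT L {x, a} := by
      ext e
      simp only [Set.mem_union, sep_mem_glueSet_iff ω hxa]
      tauto
    rw [hF]
    constructor
    · exact Or.inl
    · rintro (h | ⟨h, -⟩)
      · exact h
      · exact absurd h hr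

/-- **Structure of `T = {x ↔ a}`**: with no cross pair, `x ↔ a` iff `x ↔_L a` or `x ↔_R a`. [folklore] -/
theorem sep_conn_xa_iff {ω : BondConfig V} (hω : noCross L {x, a} ω) (hx : x ∉ L) (ha : a ∉ L) (hxa : x ≠ a) :
    (openGraph ω).Reachable x a ↔
      rB L {x, a} ω x a ∨ (openGraph (ω ∩ sideT L {x, a})).Reachable x a := by
  rw [reachable_iff_rT hω hx ha, sep_rT_glue_iff ω hxa]
  constructor
  · rintro (h | ⟨h, -⟩)
    · exact Or.inr h
    · exact Or.inl h
  · rintro (h | h)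
    · exact Or.inr ⟨h, Or.inl ⟨SimpleGraph.Reachable.refl _, SimpleGraph.Reachable.refl _⟩⟩
    · exact Or.inl h

/-- **Structure of `F = {x ↔ b}`** (`b ∈ L`): with no cross pair, `x ↔ b` iff `x ↔_L b`, or (`a ↔_L b`, `x ↮_L b` and
`x ↔_R a`) — the paper's `F = F₁ + [ab]·T_R`. [folklore] -/
theorem sep_conn_xb_iff {ω : BondConfig V} (hω : noCross L {x, a} ω) (hx : x ∉ L) (hxa : x ≠ a) {b : V} (hb : b ∈ L) :
    (openGraph ω).Reachable x b ↔
      rB L {x, a} ω x b ∨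
        (rB L {x, a} ω a b ∧ ¬ rB L {x, a} ω x b ∧ (openGraph (ω ∩ sideT L {x, a})).Reachable x a) := by
  rw [SimpleGraph.reachable_comm, reachable_iff_exists_rB_rT hω hb hx]
  constructor
  · rintro ⟨a', ha', hba', ha'x⟩
    rcases ha' with rfl | rfl
    · exact Or.inl hba'.symm
    · rw [sep_rT_glue_iff ω hxa] at ha'x
      by_cases hxb : rB L {x, a'} ω x b
      · exact Or.inl hxb
      right
      refine ⟨hba'.symm, hxb, ?_⟩
      rcases ha'x with h | ⟨h, -⟩
      · exact h.symm
      · exact absurd (h.trans hba'.symm) hxb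
  · rintro (h | ⟨hab, -, hxa'⟩)
    · exact ⟨x, Or.inl rfl, h.symm, rT_refl _ ω x⟩
    · refine ⟨a, Or.inr rfl, hab.symm, ?_⟩
      rw [sep_rT_glue_iff ω hxa]
      exact Or.inl hxa'.symm

/-- **Structure of `G = {x ↔ u}`** (`u ∉ L ∪ {x,a}`): with no cross pair, `x ↔ u` iff `x ↔_R u`, or (`a ↔_R u`, `x ↮_R u`
and `x ↔_L a`). [folklore] -/
theorem sep_conn_xu_iff {ω : BondConfig V} (hω : noCross L {x, a} ω) (hx : x ∉ L) (hxa : x ≠ a) {u : V} (hu : u ∉ L) :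
    (openGraph ω).Reachable x u ↔
      (openGraph (ω ∩ sideT L {x, a})).Reachable x u ∨
        ((openGraph (ω ∩ sideT L {x, a})).Reachable a u ∧ ¬ (openGraph (ω ∩ sideT L {x, a})).Reachable x u ∧
          rB L {x, a} ω x a) := by
  rw [reachable_iff_rT hω hx hu, sep_rT_glue_iff ω hxa]
  constructor
  · rintro (h | ⟨hr, ⟨-, hau⟩ | ⟨-, hxu⟩⟩)
    · exact Or.inl h
    · by_cases hxu : (openGraph (ω ∩ sideT L {x, a})).Reachable x u
      · exact Or.inl hxu
      · exact Or.inr ⟨hau, hxu, hr⟩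
    · exact Or.inl hxu
  · rintro (h | ⟨hau, -, hr⟩)
    · exact Or.inl h
    · exact Or.inr ⟨hr, Or.inl ⟨SimpleGraph.Reachable.refl _, hau⟩⟩

end Structure

end Summit.CriticalPhenomena.PercolationContinuityZ3.Theorems.CSH
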